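import Summits.HodgeConjecture.HodgeConjecture.Theorems.WeilTypeLadderLocalAnchor
import Summits.HodgeConjecture.HodgeConjecture.Theses.HeckePrymWeil
import Literature.AlgebraicGeometry.HodgeTheory.WeilClassesLocalTensorAnchor
import HarnessLib

/-!
# WeilTypeLadder · EVERY discriminant from local TENSOR anchors: Deligne's family through `X` itself (no reach, no det H)

b2b cell `hweil` (packet `run/shared/lean/b2b/hodge-weil/`; notes `b2b-hweil-pv2-g3/VARIATIONAL-G3.md` §5b). Prover 2,
generation 3. Non-split twin of `Theorems/WeilTypeLadderLocalAnchor.lean`. There, ONE hyperbolic local anchor plus the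
reach fact `weilFamilyReach_hyperbolic` gives the Weil classes of every HYPERBOLIC member; non-split components were out
of range because the tree has no discriminant on real carriers and no reach fact for them. Here the family is
Deligne's PEL family THROUGH THE TARGET `(X, Φ)` itself (`deligne1982_weilFamily_hodgeWeilSection`, LNM 900 proof of
Thm. 4.8, `p ≡ 3 (4)`, `p ≥ 7`; any discriminant — the construction of the FAMILY, pp. 47–51, is discriminant-free;
in van Geemen's rendering [vanGeemen1994HodgeAV, 5.3–5.7] the form `H` has arbitrary `det H = (-1)^k a`), which
carries a flat `(k,k)` Weil section through the given class and exhibits a TENSOR POINT `Y ~ A₁ × A₁` on the same base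
(on the SPLIT components Deligne's own `A₀ ⊗ K`, Thm. 4.8 (b), equivalently [Andre1996Motifs, Lemme 6.3.3]; in EVERY
component the diagonal CM member `E_K^k(ι) × E_K^k(ῑ) ∼ E_K^k ⊗ ℤ[√-p]` of van Geemen's family, obtained from the
`K`-rational choice `V₊ = span(e₁, …, e_k)` in the basis (5.4.1) — a routine step not printed as such in any of the
three sources, spelled out in the module docstring of `Literature/…/WeilFamilyFlatSections.lean` at the referee's
request, packet `GAPS.md` G19); the local input is the predicate
`HasLocallyAlgebraicTensorAnchors k p` (`Literature/…/WeilClassesLocalTensorAnchor.lean`, this seat): at every tensor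
point the section is algebraic on a neighbourhood (up to `q·Hᵏ` for some global `(1,1)`-class `H`).

* `weilClass_algebraic_of_deligne_of_tensorLocalAnchors` — for `p` prime, `p ≡ 3 (4)`, `p ≥ 7`, `k ≥ 1`:
  `deligne1982_weilFamily_hodgeWeilSection ∧ HasLocallyAlgebraicTensorAnchors k p ⟹` every rational `(k,k)` class of
  the Weil plane of EVERY complex abelian `2k`-fold `(X, Φ)` with `Φ ≫ Φ = -p` is algebraic — ALL DISCRIMINANTS.
  MECHANISM (kernel-checked): W-engine (`stub_globalClassEngine`) and rationality along the section
  (`stub_rationalAlongSection`) turn Deligne's section into a global class `W` with rational `(k,k)` restrictions,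
  `W|_{𝒳_{s₁}} = e^{-1*}c`, `W|_{𝒳_{s₀}} = x` at the tensor point; the local clause gives `U ∋ s₀`, `H`, `q` with
  `(q·Hᵏ + W)|_{𝒳_s}` algebraic on `U`; Baire / countable union (`mem_algebraicClasses_of_isOpen_subset_algebraicityLocus`)
  spreads it to `s₁`; `H_{s₁}ᵏ` is algebraic on `𝒳_{s₁} ≅ X` (Lefschetz `(1,1)` + Kleiman on `X`); transport along the
  chart. No isogeny transfer, no one-class-suffices: the family passes through `X`.
* `weilSixfoldsSqrtMinus7_of_deligne_of_tensorLocalAnchors` — crux `HeckePrymWeil.WeilSixfoldsSqrtMinus7`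
  (stmt-HodgeConjecture-1260: ALL `ℚ(√-7)` sixfolds, split AND non-split) ⟸ the fact ∧ `HasLocallyAlgebraicTensorAnchors 3 7`.
* `weilTenfoldsSqrtMinus11_of_deligne_of_tensorLocalAnchors` — crux `HeckePrymWeil.WeilTenfoldsSqrtMinus11`
  (stmt-HodgeConjecture-1262) ⟸ the fact ∧ `HasLocallyAlgebraicTensorAnchors 5 11`: the CLASS-level form of the line
  `quaternionic-norm-anchors` (`stub_perryRouteCompositionFull` = fact ∧ Perry ∧ Weil-pure semiregular object).
* `hasLocallyAlgebraicTensorAnchors_of_hodgeConjecture` — on-path: under HC the predicate holds (`U = S(ℂ)`, `H = 0`).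

Nothing is asserted; no definition; sorry-free. Serves stmt-HodgeConjecture-1260 (and 1262, 2524) without closing them.
-/

-- every declaration of this problem lives in `Summit.HodgeConjecture.HodgeConjecture.…` (summit = sub-problem)
set_option linter.dupNamespace false

noncomputable section

open CategoryTheory AlgebraicGeometry Limits MonoidalCategory CartesianMonoidalCategory

namespace Summit.HodgeConjecture.HodgeConjecture.WeilTypeLadder

open Literature.AlgebraicGeometry Literature.AlgebraicGeometry.Motives
open Literature.AlgebraicGeometry.HodgeTheory
open Literature.AlgebraicTopology.SingularHomology
open Summit.HodgeConjecture.HodgeConjecture.Theorems.HeckePrymWeilLine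
  (stub_upgrade stub_rationalAlongSection owf_isoTransport)
open Summit.HodgeConjecture.HodgeConjecture.Theorems.HyperbolicEightfoldsSqrtMinus7.TensorAnchor
  (stub_globalClassEngine)
open Summit.HodgeConjecture.HodgeConjecture.Theorems.HyperbolicEightfoldsSqrtMinus7.AnchorObject
  (complexBetti_map_cupPowTwo cupPowTwo_mem_algebraicClasses_abelian)

/-- **Weil classes of EVERY `ℚ(√-p)`-Weil abelian `2k`-fold — every discriminant — from Deligne's family through it and
locally algebraic TENSOR anchors** (`p` prime, `p ≡ 3 (4)`, `p ≥ 7`, `k ≥ 1`; hypotheses BY NAME, nothing asserted).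
Trust base of the family fact off the split components: van Geemen 5.3–5.7 (family for every `det H`) plus the
`K`-rational `V₊ = span(e₁, …, e_k)` of (5.4.1) for the tensor point (module docstring; packet G19).
[cite: Deligne1982HodgeCycles, proof of Thm. 4.8 (a)–(c)] [cite: vanGeemen1994HodgeAV, §5.3–5.7]
[cite: CharlesSchnell2014Notes, Prop. 11.3.11 (proof)] [cite: VoisinHodgeII2003, §9.2.4 Prop. 9.20] -/
theorem weilClass_algebraic_of_deligne_of_tensorLocalAnchors (p k : ℕ) (hp : p.Prime) (hp4 : p % 4 = 3)
    (hp7 : 7 ≤ p) (hk : 1 ≤ k) (hD : deligne1982_weilFamily_hodgeWeilSection)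
    (hT : HasLocallyAlgebraicTensorAnchors k p) (X : AbelianVariety ℂ) (Φ : X ⟶ X) (hX : X.dim = 2 * k)
    (hΦ : Φ ≫ Φ = -((p : ℤ) • 𝟙 X)) (c : complexBetti X.X (2 * k)) (hcW : c ∈ weilClassesOf X Φ k p)
    (hcr : IsRationalClass c) (hcH : IsOfHodgeType (2 * k) X.X (2 * k) k k c) :
    c ∈ algebraicClasses X.X k := by
  by_cases hc0 : c = 0
  · rw [hc0]; exact Submodule.zero_mem _
  obtain ⟨m, rfl⟩ : ∃ m, k = m + 1 := ⟨k - 1, by omega⟩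
  -- Deligne's family through `X`, section through `c`, tensor point at `s₀`
  obtain ⟨𝒳, S, f, s₁, s₀, e, σ, hfam, hemb, hirr, hsm, hSqp, hchart, hσc, hpt, hσH, hσ₁, Y, Ψ, e₀, x, hiso, hσ₀,
      hxW⟩ := hD p hp hp4 hp7 (m + 1) hk X Φ hX hΦ c hcW hc0 hcr hcH
  haveI := hirr
  obtain ⟨A₁, f₁, g₁, m', hA₁, hYdim, hΨ, hm', hfg, hflat, hg⟩ := hiso
  -- the total space is quasi-projective (closed in `ℙᴺ × S`)
  have h𝒳qp : IsQuasiProjectiveOver 𝒳 := by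
    obtain ⟨N, ι, hι, -⟩ := hemb
    haveI := hι
    exact IsQuasiProjectiveOver.of_isClosedImmersion_projectiveSpace_tensor ι hSqp
  -- the W-engine: `σ` is the restriction of a global class `W`
  obtain ⟨W, hWσ⟩ :=
    stub_globalClassEngine f (2 * (m + 1)) (2 * (m + 1)) hfam hemb hsm hSqp hirr σ hσc hpt
  have hcls : ∀ (s : ComplexPoints S) (y : complexBetti (fiberOver f s) (2 * (m + 1))),
      σ s = ⟨s, y⟩ → complexBetti.map (fiberι f s) (2 * (m + 1)) W = y := by
    intro s y hy
    have h := (hWσ s).symm.trans hy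
    simp only [globalSection, FiberClass.mk.injEq, heq_eq_eq, true_and] at h
    exact h
  have hW₁ : complexBetti.map (fiberι f s₁) (2 * (m + 1)) W = complexBetti.map e.inv (2 * (m + 1)) c :=
    hcls s₁ _ hσ₁
  have hW₀ : complexBetti.map (fiberι f s₀) (2 * (m + 1)) W = x := hcls s₀ _ hσ₀
  -- rationality along the section, Hodge type along the section
  have hrat₁ : IsRationalClass (σ s₁).cls := by rw [hσ₁]; exact hcr.map _
  have hratσ : ∀ s, IsRationalClass (σ s).cls :=
    stub_rationalAlongSection f (2 * (m + 1)) (2 * (m + 1)) hfam hsm hSqp hirr σ hσc hpt s₁ hrat₁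
  have hWfib : ∀ s, IsRationalClass (complexBetti.map (fiberι f s) (2 * (m + 1)) W) ∧
      IsOfHodgeType (2 * (m + 1)) (fiberOver f s) (2 * (m + 1)) (m + 1) (m + 1)
        (complexBetti.map (fiberι f s) (2 * (m + 1)) W) := by
    intro s
    have h1 := hratσ s
    have h2 := hσH s
    rw [hWσ s] at h1 h2
    exact ⟨h1, h2⟩
  -- the class at the tensor point, read on `Y`
  have hx' : complexBetti.map e₀.hom (2 * (m + 1)) (complexBetti.map (fiberι f s₀) (2 * (m + 1)) W) =
      complexBetti.map e₀.hom (2 * (m + 1)) x := by rw [hW₀]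
  have hxr : IsRationalClass (complexBetti.map e₀.hom (2 * (m + 1)) x) := by
    rw [← hW₀]; exact (hWfib s₀).1.map _
  -- THE LOCAL TENSOR ANCHOR at `(Y, Ψ, e₀^* x)`
  obtain ⟨U, H, q, hUo, hs₀U, hHfib, hUalg⟩ :=
    hT Y Ψ hYdim hΨ ⟨A₁, f₁, g₁, m', hA₁, hm', hfg, hflat, hg⟩ _ hxW hxr f hfam h𝒳qp hSqp hirr hsm hchart W hWfib
      s₀ e₀ hx'
  -- the global class `q • Hᵏ + W`; GLOBAL from LOCAL by Baire / countable union
  set B : complexBetti 𝒳 (2 * (m + 1)) := ((q : ℚ) : ℂ) • cupPowTwo H (m + 1) + W with hBdef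
  have hBres : ∀ s, complexBetti.map (fiberι f s) (2 * (m + 1)) B =
      ((q : ℚ) : ℂ) • cupPowTwo (complexBetti.map (fiberι f s) 2 H) (m + 1) +
        complexBetti.map (fiberι f s) (2 * (m + 1)) W := by
    intro s
    rw [hBdef, map_add, map_smul, complexBetti_map_cupPowTwo]
  have hBall : ∀ t : ComplexPoints S,
      complexBetti.map (fiberι f t) (2 * (m + 1)) B ∈ algebraicClasses (fiberOver f t) (m + 1) :=
    mem_algebraicClasses_of_isOpen_subset_algebraicityLocus f h𝒳qp hSqp hsm hfam B hUo ⟨s₀, hs₀U⟩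
      (fun t ht => by rw [hBres t]; exact hUalg t ht)
  have halg : ((q : ℚ) : ℂ) • cupPowTwo (complexBetti.map (fiberι f s₁) 2 H) (m + 1) +
      complexBetti.map (fiberι f s₁) (2 * (m + 1)) W ∈ algebraicClasses (fiberOver f s₁) (m + 1) := by
    rw [← hBres s₁]; exact hBall s₁
  -- `H_{s₁}ᵏ` is algebraic on `𝒳_{s₁} ≅ X`: Lefschetz (1,1) + Kleiman on the abelian `X`
  have hXsp : IsSmoothProjective (2 * (m + 1)) X.X := isSmoothProjective_of_dim_eq' hX
  have hh₁alg : complexBetti.map e.hom 2 (complexBetti.map (fiberι f s₁) 2 H) ∈ algebraicClasses X.X 1 :=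
    lefschetzOneOne_rational_holds hXsp _ ((hHfib s₁).1.map _) ((hHfib s₁).2.map_of_iso e)
  have hh₁k : complexBetti.map e.hom (2 * (m + 1)) (cupPowTwo (complexBetti.map (fiberι f s₁) 2 H) (m + 1)) ∈
      algebraicClasses X.X (m + 1) := by
    rw [complexBetti_map_cupPowTwo]
    exact cupPowTwo_mem_algebraicClasses_abelian X hh₁alg m
  have hHk : cupPowTwo (complexBetti.map (fiberι f s₁) 2 H) (m + 1) ∈ algebraicClasses (fiberOver f s₁) (m + 1) :=
    owf_isoTransport _ X e (m + 1) _ hh₁k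
  -- hence `W_{s₁} = e^{-1*} c` is algebraic, and so is `c`
  have hW₁alg : complexBetti.map e.inv (2 * (m + 1)) c ∈ algebraicClasses (fiberOver f s₁) (m + 1) := by
    rw [← hW₁]
    have h := Submodule.sub_mem _ halg (Submodule.smul_mem _ (((q : ℚ) : ℂ)) hHk)
    rwa [add_sub_cancel_left] at h
  have h := Theorems.isoInvariance_proof e (m + 1) _ hW₁alg
  rwa [e.complexBetti_map_hom_map_inv] at h

/-! ## Two cruxes of route `HeckePrymWeil` BY NAME (all discriminants) -/

/-- **Crux `WeilSixfoldsSqrtMinus7` (stmt-HodgeConjecture-1260: the Hodge–Weil classes of EVERY `ℚ(√-7)`-Weil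
abelian sixfold, split or non-split) from Deligne's family and locally algebraic tensor anchors in dimension 6.**
The typed Weil plane of the crux lies in the strong one (`stub_upgrade`, landed).
[cite: Deligne1982HodgeCycles, proof of Thm. 4.8 (a)–(c)] [cite: Markman2025SecantWeil, §1.5] -/
theorem weilSixfoldsSqrtMinus7_of_deligne_of_tensorLocalAnchors (hD : deligne1982_weilFamily_hodgeWeilSection)
    (hT : HasLocallyAlgebraicTensorAnchors 3 7) :
    Summit.HodgeConjecture.HodgeConjecture.Theses.HeckePrymWeil.WeilSixfoldsSqrtMinus7 := by
  intro A φ hA hφ c hc h33 hW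
  have hA' : A.dim = 2 * 3 := hA
  exact weilClass_algebraic_of_deligne_of_tensorLocalAnchors 7 3 (by norm_num) (by norm_num) le_rfl (by norm_num)
    hD hT A φ hA' hφ c (stub_upgrade 7 (by norm_num) (by norm_num) le_rfl 3 A φ hA' hφ hW) hc h33

/-- **Crux `WeilTenfoldsSqrtMinus11` (stmt-HodgeConjecture-1262) from Deligne's family and locally algebraic tensor
anchors in dimension 10** — the class-level form of the line `quaternionic-norm-anchors`
(`stub_perryRouteCompositionFull`: fact ∧ Perry ∧ Weil-pure semiregular object at tensor points).
[cite: Deligne1982HodgeCycles, proof of Thm. 4.8 (a)–(c)] [cite: Perry2026Semiregularity, Thm. 1.1 (2)] -/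
theorem weilTenfoldsSqrtMinus11_of_deligne_of_tensorLocalAnchors (hD : deligne1982_weilFamily_hodgeWeilSection)
    (hT : HasLocallyAlgebraicTensorAnchors 5 11) :
    Summit.HodgeConjecture.HodgeConjecture.Theses.HeckePrymWeil.WeilTenfoldsSqrtMinus11 := by
  intro A φ hA hφ c hc h55 hW
  have hA' : A.dim = 2 * 5 := hA
  exact weilClass_algebraic_of_deligne_of_tensorLocalAnchors 11 5 (by norm_num) (by norm_num) (by norm_num)
    (by norm_num) hD hT A φ hA' hφ c (stub_upgrade 11 (by norm_num) (by norm_num) (by norm_num) 5 A φ hA' hφ hW) hc h55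

/-! ## On-path: under HC the tensor predicate holds -/

/-- **`HodgeConjecture → HasLocallyAlgebraicTensorAnchors k p`**: the local clause holds with `U = S(ℂ)`, `H = 0`,
`q = 0` (`localTensorClause_of_forall_mem_algebraicClasses`). [folklore] -/
theorem hasLocallyAlgebraicTensorAnchors_of_hodgeConjecture (hHC : _root_.HodgeConjecture) (k p : ℕ) :
    HasLocallyAlgebraicTensorAnchors k p := by
  intro Y Ψ _ _ _ x _ _ 𝒳 S f hf _ _ _ _ _ W hW s₀ _ _
  exact localTensorClause_of_forall_mem_algebraicClasses f hf W s₀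
    (fun s => (hHC (hf.isSmoothProjective s)).2 k _ (hW s).1 (hW s).2)

end Summit.HodgeConjecture.HodgeConjecture.WeilTypeLadder

end
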